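import Summits.NavierStokesRegularity.NavierStokesRegularity.Theorems.CorkscrewDynamoCorkscrewProfileRotatedVorticityEq
import Summits.NavierStokesRegularity.NavierStokesRegularity.Theorems.CorkscrewDynamoCorkscrewProfileCoRotationNecessity
import Literature.Analysis.FluidPDE.PineauVicolRSSProofs
import Literature.Analysis.FluidPDE.LerayProfileCalculus
import Literature.Analysis.FluidPDE.SpaceTimeSliceCalculus
import Literature.Analysis.FluidPDE.TaoEnstrophyLocalisation
import HarnessLib

/-!
# Route CorkscrewDynamo · crux `CorkscrewProfile` (stmt-NavierStokesRegularity-11282) — stub S1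
# `stub_subcriticalStretchingSteady`: subcritical vortex stretching kills a rotated Leray profile

Stub `stub_subcriticalStretchingSteady` of line `registered` (skeleton v17, lead c7): STRETCHING NECESSITY,
elliptic form. Let `(U, P)` be a smooth divergence-free solution on `ℝ³` of Perelman's rotated Leray
profile system `α(JU − DU[Jy]) + ½U + ½DU[y] − ΔU + DU[U] + ∇P = 0` (`J = rotGen = e₃ × ·`) with the
profile Type-I decay `|U(y)| ≤ C₀/(1+|y|)`, `‖DU(y)‖ ≤ K/(1+|y|)²`. If the vortex stretching is
everywhere subcritical, `⟪ω, DU ω⟫ ≤ |ω|²` (`ω = curl U`), then `U ≡ 0`.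

Proof. By the vorticity equation of the profile (V1 `stub_rotatedVorticityEq`)
`Δω = Dω[U + ½y − αJy] + ω + αJω − DU[ω]`, the enstrophy density `Θ = |ω|²` satisfies
`ΔΘ − DΘ[U + ½y − αJy] = 2|Dω|² + 2(|ω|² − ⟪ω, DU ω⟫) ≥ 0` (`⟪Jω, ω⟫ = 0`), i.e. `Θ` is a bounded
`C²` subsolution of the co-rotating drift operator `driftOp 1 ½ (U − αJ)`; Tsai's Liouville lemma with a
skew linear drift (T1 `stub_skewDriftLiouville`) makes `Θ` constant, and the decay `|ω| ≤ ‖curl‖ K/(1+|y|)²`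
makes the constant `0`. A curl-free, divergence-free field with the decay `C₀/(1+|y|)` vanishes
(`PineauVicol2026.eq_zero_of_curl_eq_zero_of_isDivFree_of_norm_le`).
-/

noncomputable section

open MeasureTheory Set Function Filter Topology InnerProductSpace Metric
open Literature.Analysis.FluidPDE
open scoped RealInnerProductSpace Laplacian ContDiff NNReal ENNReal

namespace Summit.NavierStokesRegularity.NavierStokesRegularity.Theorems.CorkscrewProfile.Birth

set_option linter.dupNamespace false

/-- **The enstrophy density of a rotated Leray profile is a subsolution up to the stretching defect.**
For a smooth divergence-free solution `(U, P)` of `α(JU − DU[Jy]) + ½U + ½DU[y] − ΔU + DU[U] + ∇P = 0`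
and `ω = curl U`, the co-rotating drift operator of `Θ = ⟪ω, ω⟫` is
`driftOp 1 ½ (U − αJ) Θ = 2|Dω|² + 2(|ω|² − ⟪ω, DU ω⟫)`: the vorticity equation
`Δω = Dω[U + ½y − αJy] + ω + αJω − DU[ω]` (`stub_rotatedVorticityEq`), `ΔΘ = 2⟪Δω, ω⟫ + 2|Dω|²`,
`DΘ[v] = 2⟪ω, Dω v⟫` and `⟪Jω, ω⟫ = 0`. [folklore] -/
theorem driftOp_vorticitySq_rotatedProfile {α : ℝ}
    {U : EuclideanSpace ℝ (Fin 3) → EuclideanSpace ℝ (Fin 3)} {P : EuclideanSpace ℝ (Fin 3) → ℝ}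
    (hU : ContDiff ℝ (⊤ : ℕ∞) U) (hP : ContDiff ℝ (⊤ : ℕ∞) P) (hdiv : VectorCalculus.IsDivFree U)
    (heq : ∀ y : EuclideanSpace ℝ (Fin 3),
      α • (rotGen (U y) - fderiv ℝ U y (rotGen y)) + (1 / 2 : ℝ) • U y + (1 / 2 : ℝ) • fderiv ℝ U y y
        - (Δ U) y + fderiv ℝ U y (U y) + gradient P y = 0)
    (y : EuclideanSpace ℝ (Fin 3)) :
    driftOp 1 (1 / 2 : ℝ) (fun z => U z - (α • rotGenL) z) (fun z => ⟪curl U z, curl U z⟫) y =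
      2 * frobeniusNormSq (fderiv ℝ (curl U) y) +
        2 * (‖curl U y‖ ^ 2 - ⟪curl U y, fderiv ℝ U y (curl U y)⟫) := by
  have hV := stub_rotatedVorticityEq hU hP hdiv heq y
  have hU3 : ContDiff ℝ 3 U := hU.of_le (WithTop.coe_le_coe.2 le_top)
  have hω2 : ContDiff ℝ 2 (curl U) := contDiff_curl (n := 2) (by exact_mod_cast hU3)
  have hωd : Differentiable ℝ (curl U) := hω2.differentiable (by simp)
  simp only [driftOp, _root_.smul_apply, rotGenL_apply, one_mul]
  rw [laplacian_inner_self_eq hω2 y, fderiv_inner_self_apply (hωd y), hV]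
  have hb : U y - α • rotGen y + (1 / 2 : ℝ) • y = U y + (1 / 2 : ℝ) • y - α • rotGen y := by abel
  rw [hb, inner_sub_left, inner_add_left, inner_add_left, real_inner_smul_left, inner_rotGen_self,
    real_inner_self_eq_norm_sq, real_inner_comm (curl U y) (fderiv ℝ (curl U) y _),
    real_inner_comm (curl U y) (fderiv ℝ U y (curl U y))]
  ring

/-- **Stub S1 `stub_subcriticalStretchingSteady` — subcritical vortex stretching kills a rotated Leray
profile** (line `registered` of crux stmt-NavierStokesRegularity-11282). A smooth divergence-free solution
`(U, P)` on `ℝ³` of Perelman's rotated Leray profile system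
`α(JU − DU[Jy]) + ½U + ½DU[y] − ΔU + DU[U] + ∇P = 0` with the profile Type-I decay
`|U(y)| ≤ C₀/(1+|y|)`, `‖DU(y)‖ ≤ K/(1+|y|)²`, whose vortex stretching is everywhere subcritical,
`⟪ω, DU ω⟫ ≤ |ω|²` (`ω = curl U`), is trivial: `Θ = |ω|²` is a bounded `C²` subsolution of the
co-rotating drift operator (`driftOp_vorticitySq_rotatedProfile`), hence constant by Tsai's Liouville
lemma with a skew drift (`stub_skewDriftLiouville`), hence `0` by the decay of `ω`; and a curl-free
divergence-free field with the decay `C₀/(1+|y|)` vanishes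
(`PineauVicol2026.eq_zero_of_curl_eq_zero_of_isDivFree_of_norm_le`). [cite: Tsai1998, Lemma 5.1] -/
theorem stub_subcriticalStretchingSteady {α C₀ K : ℝ}
    {U : EuclideanSpace ℝ (Fin 3) → EuclideanSpace ℝ (Fin 3)} {P : EuclideanSpace ℝ (Fin 3) → ℝ}
    (hU : ContDiff ℝ (⊤ : ℕ∞) U) (hP : ContDiff ℝ (⊤ : ℕ∞) P) (hdiv : VectorCalculus.IsDivFree U)
    (heq : ∀ y : EuclideanSpace ℝ (Fin 3),
      α • (rotGen (U y) - fderiv ℝ U y (rotGen y)) + (1 / 2 : ℝ) • U y + (1 / 2 : ℝ) • fderiv ℝ U y y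
        - (Δ U) y + fderiv ℝ U y (U y) + gradient P y = 0)
    (hdec : ∀ y : EuclideanSpace ℝ (Fin 3), ‖U y‖ ≤ C₀ / (1 + ‖y‖))
    (hD1 : ∀ y : EuclideanSpace ℝ (Fin 3), ‖fderiv ℝ U y‖ ≤ K / (1 + ‖y‖) ^ 2)
    (hstretch : ∀ y : EuclideanSpace ℝ (Fin 3), ⟪curl U y, fderiv ℝ U y (curl U y)⟫ ≤ ‖curl U y‖ ^ 2) :
    U = 0 := by
  have hU2 : ContDiff ℝ 2 U := hU.of_le (WithTop.coe_le_coe.2 le_top)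
  have hU3 : ContDiff ℝ 3 U := hU.of_le (WithTop.coe_le_coe.2 le_top)
  have hω2 : ContDiff ℝ 2 (curl U) := contDiff_curl (n := 2) (by exact_mod_cast hU3)
  -- the enstrophy density `Θ = |ω|²` is a `C²` subsolution of the co-rotating drift operator
  have hΘ2 : ContDiff ℝ 2 (fun z => ⟪curl U z, curl U z⟫) := hω2.inner ℝ hω2
  have hsub : ∀ y, 0 ≤ driftOp 1 (1 / 2 : ℝ) (fun z => U z - (α • rotGenL) z)
      (fun z => ⟪curl U z, curl U z⟫) y := by
    intro y
    rw [driftOp_vorticitySq_rotatedProfile hU hP hdiv heq y]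
    have h1 := frobeniusNormSq_nonneg (fderiv ℝ (curl U) y)
    have h2 := hstretch y
    nlinarith
  -- `0 ≤ K` and the decay of the vorticity `|ω(y)| ≤ ‖curl‖ K / (1 + |y|)`
  have hK : 0 ≤ K := by
    have h := hD1 0
    rw [norm_zero, add_zero, one_pow, div_one] at h
    exact (norm_nonneg _).trans h
  have hωdec : ∀ y : EuclideanSpace ℝ (Fin 3), ‖curl U y‖ ≤ ‖curlCLM‖ * K / (1 + ‖y‖) := by
    intro y
    have h1 : (1 : ℝ) ≤ 1 + ‖y‖ := by linarith [norm_nonneg y]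
    calc ‖curl U y‖ ≤ ‖curlCLM‖ * ‖fderiv ℝ U y‖ := norm_curl_le U y
      _ ≤ ‖curlCLM‖ * (K / (1 + ‖y‖) ^ 2) := by gcongr; exact hD1 y
      _ ≤ ‖curlCLM‖ * (K / (1 + ‖y‖)) := by
          gcongr
          exact le_self_pow₀ h1 two_ne_zero
      _ = ‖curlCLM‖ * K / (1 + ‖y‖) := by ring
  obtain ⟨-, hωb, hyω⟩ := bounds_of_profile_decay hωdec
  -- Tsai's Liouville lemma with the skew drift `αJ`: `Θ` is constant
  obtain ⟨-, hUb, -⟩ := bounds_of_profile_decay hdec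
  have hUaff : ∀ y, ‖U y‖ ≤ C₀ + 0 * ‖y‖ := fun y => by rw [zero_mul, add_zero]; exact hUb y
  have hgrowth : ∀ y, |(fun z => ⟪curl U z, curl U z⟫) y| ≤ (‖curlCLM‖ * K) ^ 2 * (1 + ‖y‖) ^ 0 := by
    intro y
    rw [pow_zero, mul_one]
    show |⟪curl U y, curl U y⟫| ≤ (‖curlCLM‖ * K) ^ 2
    rw [real_inner_self_eq_norm_sq, abs_of_nonneg (sq_nonneg _)]
    exact pow_le_pow_left₀ (norm_nonneg _) (hωb y) 2
  have hconst : ∀ x y, (fun z => ⟪curl U z, curl U z⟫) x = (fun z => ⟪curl U z, curl U z⟫) y :=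
    fun x y => stub_skewDriftLiouville one_pos le_rfl (by norm_num : (0 : ℝ) < 1 / 2) (α • rotGenL)
      (inner_skew_self_eq_zero (α • rotGenL) (inner_smul_rotGenL_skew α)) hΘ2 hsub hUaff hgrowth x y
  -- the constant is `0`: `|ω|` is constant and `|y| |ω(y)| ≤ ‖curl‖ K`
  have hnorm : ∀ z, ‖curl U z‖ = ‖curl U 0‖ := by
    intro z
    have h := hconst z 0
    simp only [real_inner_self_eq_norm_sq] at h
    exact (sq_eq_sq₀ (norm_nonneg _) (norm_nonneg _)).1 h
  have hcurl : ∀ y, curl U y = 0 := by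
    suffices h0 : curl U 0 = 0 by
      intro y
      rw [← norm_eq_zero, hnorm y, h0, norm_zero]
    by_contra hne
    have hc : 0 < ‖curl U 0‖ := norm_pos_iff.2 hne
    obtain ⟨w, hw⟩ := exists_norm_eq (EuclideanSpace ℝ (Fin 3))
      (show (0 : ℝ) ≤ ‖curlCLM‖ * K / ‖curl U 0‖ + 1 by positivity)
    have h := hyω w
    rw [hnorm w, hw, add_mul, one_mul, div_mul_cancel₀ _ hc.ne'] at h
    linarith
  exact PineauVicol2026.eq_zero_of_curl_eq_zero_of_isDivFree_of_norm_le hU2 hcurl hdiv hdec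

end Summit.NavierStokesRegularity.NavierStokesRegularity.Theorems.CorkscrewProfile.Birth
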